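import Literature.Topology.FourManifolds.LatticeFormsStableOrthogonalGroupNegReflectionsL2d
import Literature.Topology.FourManifolds.LatticeFormsTwoElementaryInvolution
import HarnessLib

/-!
# The involution `σ̃_r` of an even unimodular lattice attached to a `(−2d)`-reflective vector of `ℓ^⊥`, and the
# `2`-elementarity of `r^⊥ ∩ ℓ^⊥` and of its orthogonal complement
# (Gritsenko–Hulek–Sankaran, *The Kodaira dimension of the moduli of K3 surfaces*, §4 Lemma 4.5 and the proof of Prop. 4.6 of arXiv:math/0607339)

Trunk T-4MAN vocabulary; sequel of `LatticeFormsStableOrthogonalGroupNegReflectionsL2d.lean` (row g40-#2: Cor. 4.4,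
the `(−2d)`-vectors `r` of `L_{2d}` with `div(r) ∈ {d, 2d}` are exactly those whose reflection induces `−id` on the
discriminant group) and of `LatticeFormsTwoElementaryInvolution.lean` (GHS Lemma 4.5 = Alexeev–Nikulin §2.2: the
invariant and anti-invariant lattices of an isometric involution of a unimodular lattice are `2`-elementary).
Written for lane `lit-hodgefound` (Track 2 foundations; prover seat `lit-hodgefound-p18`, gen 40, row g40-#3).
THEOREMS ONLY — no definition, no named fact, no instance, no notation.

The setting is abstract: `Λ = (M, B)` is ANY even unimodular lattice (in GHS: `L_{K3} = 3U ⊕ 2E₈(−1)`), `ℓ ∈ Λ` is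
primitive with `(ℓ, ℓ) = 2d > 0` (GHS's `h`; so `ℓ^⊥` is GHS's `L_{2d}` when `Λ = L_{K3}`), and `r ∈ ℓ^⊥` is
primitive with `(r, r) = −2d` and `d ∣ (r, w)` for every `w ∈ ℓ^⊥` — i.e. `div_{ℓ^⊥}(r) ∈ {d, 2d}` (`div(r)`
divides `r² = −2d`), which by Cor. 4.4 is the condition "`σ_r` induces `−id` on `A_{L_{2d}}`" for a `(−2d)`-vector.
GHS's `L_r = r^⊥_{L_{2d}}` is `K = {ℓ, r}^⊥ = B.orthogonal (span {ℓ, r})` and `S_r = (L_r)^⊥_{L_{K3}}` is `K^⊥`.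

## Source, verbatim (held text `paper:arxiv-math_0607339` p. 15, arXiv numbering §4)

"**Lemma 4.5.** Let `T` be a primitive sublattice of an unimodular even lattice `M`, and let `S` be the
orthogonal complement of `T` in `M`. Suppose that there is an involution `σ ∈ O(M)` such that `σ|_T = id_T` and
`σ|_S = −id_S`. Then `T` and `S` are `2`-elementary lattices. […]
**Proposition 4.6.** Let `r` be a primitive vector of `L_{2d}`. If `div(r) = 2d` then `r^⊥_{L_{2d}} ≅ 2U ⊕ 2E₈(−1)`.
If `div(r) = d` then either `r^⊥_{L_{2d}} ≅ U ⊕ 2E₈(−1) ⊕ ⟨2⟩ ⊕ ⟨−2⟩` or `r^⊥_{L_{2d}} ≅ U ⊕ 2E₈(−1) ⊕ U(2)`.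
*Proof.* The lattice `L_{2d}` is the orthogonal complement of a primitive vector `h`, with `h² = 2d` in the
unimodular K3 lattice `L_{K3} = 3U ⊕ 2E₈(−1)`. We put `L_r = r^⊥_{L_{2d}}` and `S_r = (L_r)^⊥_{L_{K3}}`. […] If
`div(r) = d` then the reflection `σ_r` acts as `−id` on the discriminant group (see Corollary 4.4). Therefore we can
extend `−σ_r ∈ Õ(L_{2d})` to an element of `O(L_{K3})` by putting `(−σ_r)|_{ℤh} = id`. So `σ_r` has an extension
`σ̃_r ∈ O(L_{K3})` such that `σ̃_r|_{L_r} = id_{L_r}` and `σ̃_r|_{S_r} = −id_{S_r}`. It follows from Lemma 4.5 that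
`L_r` and `S_r` are `2`-elementary lattices."

## What is here (all proved), and how

The extension `σ̃_r` is constructed DIRECTLY on `Λ` (no gluing): fix `x₀ ∈ Λ` with `(x₀, ℓ) = 1` (unimodularity,
`ℓ` primitive) and put `t = (r, x₀)`. Since `w − (w,ℓ)x₀ ∈ ℓ^⊥`, the divisibility hypothesis gives
`(r, w) ≡ t·(ℓ, w) (mod d)` for ALL `w ∈ Λ` (§1, the abstract form of GHS's "`r = dm₀ + xh`"); the functional
`((r,·) − t(ℓ,·))/d` is then integral, so `= (p, ·)` with `dp = r − tℓ`, and `d²p² = 2d(t² − 1)` with `p²` even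
gives `d ∣ t² − 1` ("`x² = 1 − d(m₀²/2)`"). Hence the symmetric bilinear form `Φ(w,u) = (r,w)(r,u) − (ℓ,w)(ℓ,u)` is
divisible by `d`, and unimodularity provides `P : Λ → Λ` with `d·(Pw, u) = Φ(w, u)`. Then `σ̃ = id + P` is an
isometric involution of `Λ` (`(Pw, Pu) = −2(Pw, u)`, `P² = −2P`) with `σ̃ℓ = −ℓ`, `σ̃r = −r`, and
`σ̃w = w ⟺ w ⊥ ℓ, r` (`r` primitive) — §2. §3: `K = {ℓ,r}^⊥` is the invariant lattice of `σ̃` and `K^⊥` its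
anti-invariant lattice (using only that `K` is nondegenerate, which the involution also shows), so both are
`2`-elementary by Lemma 4.5 (`isTwoElementary_restrict_of_involution_invariant` / `…_antiInvariant` of the tree).

* §1 `exists_apply_eq_one_of_isUnimodular_of_primitive`, `dvd_apply_sub_mul_apply` (`(r,w) ≡ t(ℓ,w)`),
  `dvd_mul_self_sub_one_of_neg_vector` (`d ∣ t² − 1`), `dvd_mul_sub_mul_of_neg_vector` (`d ∣ Φ(w,u)`).
* §2 `exists_isometric_involution_of_neg_vector` (the involution `σ̃_r`, with `σ̃ℓ = −ℓ`, `σ̃r = −r`,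
  `σ̃w = w ⟺ (w,ℓ) = (w,r) = 0`).
* §3 `mem_orthogonal_span_pair_iff`; `nondegenerate_restrict_orthogonal_span_pair_of_neg_vector` (`L_r` nondegenerate),
  **`isTwoElementary_restrict_orthogonal_span_pair_of_neg_vector` (`L_r` is `2`-elementary)**,
  `mem_orthogonal_orthogonal_span_pair_iff_of_neg_vector` (`S_r = K^⊥` is the anti-invariant lattice),
  **`isTwoElementary_restrict_orthogonal_orthogonal_span_pair_of_neg_vector` (`S_r` is `2`-elementary)**.

NOT here (row g40-#4): the identification of `L_r` with `2U ⊕ 2E₈(−1)`, `U ⊕ 2E₈(−1) ⊕ ⟨2⟩ ⊕ ⟨−2⟩`,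
`U ⊕ 2E₈(−1) ⊕ U(2)` for `Λ` of signature `(3, 19)` (Prop. 4.6 proper), which needs ranks and signatures.

## References

* [GritsenkoHulekSankaran2007Kodaira] V. Gritsenko, K. Hulek, G. K. Sankaran, The Kodaira dimension of the moduli
  of K3 surfaces, Invent. Math. 169 (2007) 519–567 (arXiv:math/0607339): §4 (arXiv numbering) Lemma 4.5,
  Prop. 4.6 and its proof.
* [AlexeevNikulin2006] V. Alexeev, V. V. Nikulin, Del Pezzo and K3 surfaces, MSJ Memoirs 15 (2006), §2.2
  (invariant lattices of involutions are `2`-elementary).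
-/

noncomputable section

open Module Function
open LinearMap (BilinForm)
open LinearMap.BilinForm

namespace Literature.Topology.FourManifolds

universe u

variable {M : Type u} [AddCommGroup M] [Module.Free ℤ M] [Module.Finite ℤ M] (B : BilinForm ℤ M)

/-! ### §1 Congruences: `(r, w) ≡ t·(ℓ, w) (mod d)` and `d ∣ t² − 1` -/

section Congruences

/-- In a unimodular lattice a primitive `ℓ` has a partner `x₀` with `(x₀, ℓ) = 1` (the coordinate functional of the
saturated line `ℤℓ` is represented by a lattice vector). [cite: GritsenkoHulekSankaran2007Kodaira, §4 (arXiv numbering) proof of Prop. 4.6 ("`h` is primitive")] -/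
theorem exists_apply_eq_one_of_isUnimodular_of_primitive (hu : B.IsUnimodular) {ℓ : M} (hℓ0 : ℓ ≠ 0)
    (hℓsat : ∀ (k : ℤ) (w : M), k ≠ 0 → k • w ∈ ℤ ∙ ℓ → w ∈ ℤ ∙ ℓ) : ∃ x₀ : M, B x₀ ℓ = 1 := by
  haveI : B.IsPerfPair := hu
  obtain ⟨φ, hφ⟩ := exists_dual_apply_eq_one_of_primitive hℓ0 hℓsat
  obtain ⟨x₀, hx₀⟩ := (LinearMap.IsPerfPair.bijective_left B).2 φ
  exact ⟨x₀, by rw [hx₀, hφ]⟩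

omit [Module.Free ℤ M] [Module.Finite ℤ M] in
/-- **`(r, w) ≡ t·(ℓ, w) (mod d)` for all `w ∈ Λ`**, `t = (r, x₀)`, `(x₀, ℓ) = 1`: `w − (w,ℓ)x₀ ∈ ℓ^⊥`, where `(r, ·)` is
divisible by `d` — the abstract form of "any `r ∈ L_{2d}` can be written as `r = m + xh`", "`r = dm₀ + xh`".
[cite: GritsenkoHulekSankaran2007Kodaira, §4 (arXiv numbering) proof of Cor. 4.4 and of Prop. 4.6] -/
theorem dvd_apply_sub_mul_apply {ℓ r x₀ : M} {d : ℤ} (hx₀ : B x₀ ℓ = 1) (hdvd : ∀ w, B w ℓ = 0 → d ∣ B r w) (w : M) :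
    d ∣ B r w - B r x₀ * B w ℓ := by
  have h1 : B (w - B w ℓ • x₀) ℓ = 0 := by
    rw [map_sub, map_smul, LinearMap.sub_apply, LinearMap.smul_apply, smul_eq_mul, hx₀, mul_one, sub_self]
  have h2 := hdvd _ h1
  rwa [map_sub, map_smul, smul_eq_mul, mul_comm] at h2

omit [Module.Free ℤ M] [Module.Finite ℤ M] in
/-- **`d ∣ t² − 1`** (`t = (r, x₀)`, `(x₀,ℓ) = 1`) for `r ∈ ℓ^⊥` with `(r,r) = −2d`, `d ∣ (r, ℓ^⊥)`, `(ℓ,ℓ) = 2d` in an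
even unimodular `Λ`: the functional `((r,·) − t(ℓ,·))/d` is integral (§1), hence `(p, ·)` with `dp = r − tℓ`, and
`d²p² = (r − tℓ)² = 2d(t² − 1)` with `p²` even — GHS's "`x² = 1 − d(m₀²/2)`".
[cite: GritsenkoHulekSankaran2007Kodaira, §4 (arXiv numbering) proof of Cor. 4.4 ("`r = dm₀ + xh`, where `x² = 1 − d(m₀²/2)`")] -/
theorem dvd_mul_self_sub_one_of_neg_vector (hs : B.IsSymm) (he : B.IsEven) (hu : B.IsUnimodular) {ℓ r x₀ : M}
    {d : ℤ} (hd0 : d ≠ 0) (hℓ : B ℓ ℓ = 2 * d) (hrℓ : B r ℓ = 0) (hr : B r r = -(2 * d)) (hx₀ : B x₀ ℓ = 1)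
    (hdvd : ∀ w, B w ℓ = 0 → d ∣ B r w) : d ∣ B r x₀ * B r x₀ - 1 := by
  haveI : B.IsPerfPair := hu
  set t := B r x₀ with ht
  have hu' : ∀ z, d ∣ B (r - t • ℓ) z := fun z ↦ by
    rw [map_sub, map_smul, LinearMap.sub_apply, LinearMap.smul_apply, smul_eq_mul, hs.eq ℓ z]
    exact dvd_apply_sub_mul_apply B hx₀ hdvd z
  obtain ⟨f, hf⟩ := exists_dual_smul_eq_of_forall_dvd B hu'
  obtain ⟨p, hp⟩ := (LinearMap.IsPerfPair.bijective_left B).2 f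
  have hdp : d • p = r - t • ℓ := injective_of_nondegenerate B hu.nondegenerate (by rw [map_smul, hp, hf])
  obtain ⟨k, hk⟩ := he p
  have h1 : B (d • p) (d • p) = d * d * (k + k) := by
    simp only [map_smul, LinearMap.smul_apply, smul_eq_mul, hk]
    ring
  rw [hdp] at h1
  simp only [map_sub, map_smul, LinearMap.sub_apply, LinearMap.smul_apply, smul_eq_mul, hr, hrℓ, hs.eq ℓ r, hℓ]
    at h1
  have h2 : 2 * (d * (d * k - (t * t - 1))) = 0 := by linear_combination -h1
  have h3 : d * k - (t * t - 1) = 0 :=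
    (mul_eq_zero.1 ((mul_eq_zero.1 h2).resolve_left two_ne_zero)).resolve_left hd0
  exact ⟨k, by linarith⟩

omit [Module.Free ℤ M] [Module.Finite ℤ M] in
/-- **`d ∣ (r,w)(r,u) − (w,ℓ)(ℓ,u)` for all `w, u ∈ Λ`**: by `(r,·) ≡ t(ℓ,·)` and `t² ≡ 1 (mod d)`.
[cite: GritsenkoHulekSankaran2007Kodaira, §4 (arXiv numbering) proof of Cor. 4.4 / Prop. 4.6] -/
theorem dvd_mul_sub_mul_of_neg_vector (hs : B.IsSymm) {ℓ r x₀ : M} {d : ℤ} (hx₀ : B x₀ ℓ = 1)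
    (hdvd : ∀ w, B w ℓ = 0 → d ∣ B r w) (ht : d ∣ B r x₀ * B r x₀ - 1) (w u : M) :
    d ∣ B r w * B r u - B w ℓ * B ℓ u := by
  obtain ⟨a, ha⟩ := dvd_apply_sub_mul_apply B hx₀ hdvd w
  obtain ⟨b, hb⟩ := dvd_apply_sub_mul_apply B hx₀ hdvd u
  obtain ⟨c, hc⟩ := ht
  rw [hs.eq ℓ u]
  exact ⟨c * B w ℓ * B u ℓ + B r x₀ * B w ℓ * b + a * B r x₀ * B u ℓ + d * a * b, by
    linear_combination (B r x₀ * B u ℓ + d * b) * ha + (B r w) * hb + (B w ℓ * B u ℓ) * hc⟩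

end Congruences

/-! ### §2 The involution `σ̃_r = id + P` -/

section Involution

/-- **The extension `σ̃_r ∈ O(Λ)`** ("`σ_r` has an extension `σ̃_r ∈ O(L_{K3})` such that `σ̃_r|_{L_r} = id_{L_r}` and
`σ̃_r|_{S_r} = −id_{S_r}`"), constructed directly: for an even unimodular `Λ`, `ℓ` primitive with `(ℓ,ℓ) = 2d > 0`,
`r ⊥ ℓ` primitive with `(r,r) = −2d` and `d ∣ (r, w)` for all `w ⊥ ℓ`, there is a `ℤ`-linear isometric involution
`σ̃` of `Λ` with `σ̃ℓ = −ℓ`, `σ̃r = −r`, whose fixed vectors are exactly the `w ⊥ ℓ, r` (`σ̃ = id + P`,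
`d·(Pw,u) = (r,w)(r,u) − (w,ℓ)(ℓ,u)`). [cite: GritsenkoHulekSankaran2007Kodaira, §4 (arXiv numbering) proof of Prop. 4.6 ("So `σ_r` has an extension `σ̃_r ∈ O(L_{K3})` such that `σ̃_r|_{L_r} = id_{L_r}` and `σ̃_r|_{S_r} = −id_{S_r}`")] -/
theorem exists_isometric_involution_of_neg_vector (hs : B.IsSymm) (he : B.IsEven) (hu : B.IsUnimodular)
    {ℓ r : M} {d : ℤ} (hd : 0 < d) (hℓ : B ℓ ℓ = 2 * d)
    (hℓsat : ∀ (k : ℤ) (w : M), k ≠ 0 → k • w ∈ ℤ ∙ ℓ → w ∈ ℤ ∙ ℓ) (hrℓ : B r ℓ = 0) (hr : B r r = -(2 * d))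
    (hrsat : ∀ (k : ℤ) (w : M), k ≠ 0 → k • w ∈ ℤ ∙ r → w ∈ ℤ ∙ r) (hdvd : ∀ w, B w ℓ = 0 → d ∣ B r w) :
    ∃ θ : M →ₗ[ℤ] M, (∀ x y, B (θ x) (θ y) = B x y) ∧ (∀ x, θ (θ x) = x) ∧ θ ℓ = -ℓ ∧ θ r = -r ∧
      ∀ w, θ w = w ↔ B w ℓ = 0 ∧ B w r = 0 := by
  haveI : B.IsPerfPair := hu
  have hB : B.Nondegenerate := hu.nondegenerate
  have hd0 : d ≠ 0 := hd.ne'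
  have hℓ0 : ℓ ≠ 0 := by
    rintro rfl
    simp only [map_zero] at hℓ
    omega
  have hr0 : r ≠ 0 := by
    rintro rfl
    simp only [map_zero] at hr
    omega
  obtain ⟨x₀, hx₀⟩ := exists_apply_eq_one_of_isUnimodular_of_primitive B hu hℓ0 hℓsat
  obtain ⟨x₁, hx₁⟩ := exists_apply_eq_one_of_isUnimodular_of_primitive B hu hr0 hrsat
  have ht := dvd_mul_self_sub_one_of_neg_vector B hs he hu hd0 hℓ hrℓ hr hx₀ hdvd
  have hΦ := dvd_mul_sub_mul_of_neg_vector B hs hx₀ hdvd ht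
  -- `P` on a basis: `d • B (P (b i)) = Φ(b i, ·)`
  let b := Module.Free.chooseBasis ℤ M
  have hex : ∀ i, ∃ p : M, (d : ℤ) • B p = B r (b i) • B r - B (b i) ℓ • B ℓ := fun i ↦ by
    have hdv : ∀ z, d ∣ B (B r (b i) • r - B (b i) ℓ • ℓ) z := fun z ↦ by
      rw [map_sub, map_smul, map_smul, LinearMap.sub_apply, LinearMap.smul_apply, LinearMap.smul_apply, smul_eq_mul,
        smul_eq_mul]
      exact hΦ (b i) z
    obtain ⟨f, hf⟩ := exists_dual_smul_eq_of_forall_dvd B hdv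
    obtain ⟨p, hp⟩ := (LinearMap.IsPerfPair.bijective_left B).2 f
    refine ⟨p, ?_⟩
    rw [hp, hf, map_sub, map_smul, map_smul]
  choose p hp using hex
  let P : M →ₗ[ℤ] M := b.constr ℤ p
  -- `d·(Pw, u) = (r,w)(r,u) − (w,ℓ)(ℓ,u)`
  have hP : ∀ w u, d * B (P w) u = B r w * B r u - B w ℓ * B ℓ u := by
    have key : ((d : ℤ) • ((B : M →ₗ[ℤ] Module.Dual ℤ M) ∘ₗ P)) =
        (B r).smulRight (B r) - (B ℓ).smulRight (B ℓ) := by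
      refine b.ext fun i ↦ ?_
      rw [LinearMap.smul_apply, LinearMap.comp_apply, show P (b i) = p i from b.constr_basis ℤ p i, hp i,
        LinearMap.sub_apply, LinearMap.smulRight_apply, LinearMap.smulRight_apply, hs.eq (b i) ℓ]
    intro w u
    have := LinearMap.congr_fun (LinearMap.congr_fun key w) u
    rw [LinearMap.smul_apply, LinearMap.comp_apply, LinearMap.smul_apply, smul_eq_mul, LinearMap.sub_apply,
      LinearMap.smulRight_apply, LinearMap.smulRight_apply, LinearMap.sub_apply, LinearMap.smul_apply,
      LinearMap.smul_apply, smul_eq_mul, smul_eq_mul, hs.eq ℓ w] at this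
    exact this
  -- consequences
  have hPsymm : ∀ w u, B (P w) u = B w (P u) := fun w u ↦ by
    refine mul_left_cancel₀ hd0 ?_
    rw [hP, hs.eq w (P u), hP, hs.eq ℓ u, hs.eq ℓ w]; ring
  have hPr : ∀ w, B (P w) r = -2 * B r w := fun w ↦ by
    refine mul_left_cancel₀ hd0 ?_
    rw [hP, hr, hs.eq ℓ r, hrℓ]; ring
  have hPℓ : ∀ w, B (P w) ℓ = -2 * B w ℓ := fun w ↦ by
    refine mul_left_cancel₀ hd0 ?_
    rw [hP, hrℓ, hℓ]; ring
  have hPP : ∀ w u, B (P w) (P u) = -2 * B (P w) u := fun w u ↦ by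
    refine mul_left_cancel₀ hd0 ?_
    rw [hP w (P u), hs.eq r (P u), hPr, hs.eq ℓ (P u), hPℓ, hs.eq u ℓ]
    linear_combination 2 * hP w u
  have hP2 : ∀ w, P (P w) = (-2 : ℤ) • P w := fun w ↦ by
    refine injective_of_nondegenerate B hB (LinearMap.ext fun u ↦ ?_)
    rw [map_smul, LinearMap.smul_apply, smul_eq_mul]
    refine mul_left_cancel₀ hd0 ?_
    rw [hP (P w) u, hs.eq r (P w), hPr, hPℓ]
    linear_combination 2 * hP w u
  refine ⟨LinearMap.id + P, fun x y ↦ ?_, fun x ↦ ?_, ?_, ?_, fun w ↦ ?_⟩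
  · -- isometry
    rw [LinearMap.add_apply, LinearMap.add_apply, LinearMap.id_apply, LinearMap.id_apply, map_add, map_add,
      LinearMap.add_apply, LinearMap.add_apply, hPP, ← hPsymm]
    ring
  · -- involution
    rw [LinearMap.add_apply, LinearMap.id_apply, LinearMap.add_apply, LinearMap.id_apply, map_add, hP2]
    module
  · -- `σ̃ ℓ = −ℓ`: `P ℓ = −2ℓ`
    have h : P ℓ = (-2 : ℤ) • ℓ := by
      refine injective_of_nondegenerate B hB (LinearMap.ext fun u ↦ ?_)
      rw [map_smul, LinearMap.smul_apply, smul_eq_mul]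
      refine mul_left_cancel₀ hd0 ?_
      rw [hP, hrℓ, hℓ]; ring
    rw [LinearMap.add_apply, LinearMap.id_apply, h]
    module
  · -- `σ̃ r = −r`: `P r = −2r`
    have h : P r = (-2 : ℤ) • r := by
      refine injective_of_nondegenerate B hB (LinearMap.ext fun u ↦ ?_)
      rw [map_smul, LinearMap.smul_apply, smul_eq_mul]
      refine mul_left_cancel₀ hd0 ?_
      rw [hP, hr, hrℓ]; ring
    rw [LinearMap.add_apply, LinearMap.id_apply, h]
    module
  · -- fixed vectors
    rw [LinearMap.add_apply, LinearMap.id_apply, add_eq_left]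
    constructor
    · intro hw
      have h0 : ∀ u, B r w * B r u - B w ℓ * B ℓ u = 0 := fun u ↦ by rw [← hP, hw, map_zero, LinearMap.zero_apply, mul_zero]
      have h1 := h0 ℓ
      rw [hrℓ, mul_zero, zero_sub, neg_eq_zero, hℓ] at h1
      have hwℓ : B w ℓ = 0 := by
        rcases mul_eq_zero.1 h1 with h | h
        · exact h
        · omega
      have h2 := h0 x₁
      rw [hwℓ, zero_mul, sub_zero, hs.eq r x₁, hx₁, mul_one] at h2
      exact ⟨hwℓ, by rw [hs.eq w r]; exact h2⟩
    · rintro ⟨hwℓ, hwr⟩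
      refine injective_of_nondegenerate B hB (LinearMap.ext fun u ↦ ?_)
      rw [map_zero, LinearMap.zero_apply]
      refine mul_left_cancel₀ hd0 ?_
      rw [hP, hs.eq r w, hwr, hwℓ]; ring

end Involution

/-! ### §3 `L_r = {ℓ, r}^⊥` and `S_r = L_r^⊥` are `2`-elementary (Lemma 4.5) -/

section TwoElementary

omit [Module.Free ℤ M] [Module.Finite ℤ M] in
/-- `w ∈ {ℓ, r}^⊥ ⟺ (ℓ, w) = 0 ∧ (r, w) = 0` (Mathlib's `B.orthogonal N = {m | ∀ n ∈ N, B n m = 0}`). [folklore] -/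
private theorem mem_orthogonal_span_pair_iff {ℓ r w : M} :
    w ∈ B.orthogonal (Submodule.span ℤ {ℓ, r}) ↔ B ℓ w = 0 ∧ B r w = 0 := by
  rw [LinearMap.BilinForm.mem_orthogonal_iff]
  constructor
  · intro h
    exact ⟨h ℓ (Submodule.subset_span (by simp)), h r (Submodule.subset_span (by simp))⟩
  · rintro ⟨hℓ, hr⟩ n hn
    obtain ⟨a, c, rfl⟩ := Submodule.mem_span_pair.1 hn
    change B (a • ℓ + c • r) w = 0
    rw [map_add, map_smul, map_smul, LinearMap.add_apply, LinearMap.smul_apply, LinearMap.smul_apply, hℓ, hr,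
      smul_zero, smul_zero, add_zero]

/-- **`L_r = r^⊥_{ℓ^⊥} = {ℓ, r}^⊥` is nondegenerate** (for `v ∈ L_r ∩ L_r^⊥` and any `u`, `u + σ̃u ∈ L_r`, so
`0 = (v, u + σ̃u) = 2(v, u)`). [cite: GritsenkoHulekSankaran2007Kodaira, §4 (arXiv numbering) proof of Prop. 4.6] -/
theorem nondegenerate_restrict_orthogonal_span_pair_of_neg_vector (hs : B.IsSymm) (he : B.IsEven)
    (hu : B.IsUnimodular) {ℓ r : M} {d : ℤ} (hd : 0 < d) (hℓ : B ℓ ℓ = 2 * d)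
    (hℓsat : ∀ (k : ℤ) (w : M), k ≠ 0 → k • w ∈ ℤ ∙ ℓ → w ∈ ℤ ∙ ℓ) (hrℓ : B r ℓ = 0) (hr : B r r = -(2 * d))
    (hrsat : ∀ (k : ℤ) (w : M), k ≠ 0 → k • w ∈ ℤ ∙ r → w ∈ ℤ ∙ r) (hdvd : ∀ w, B w ℓ = 0 → d ∣ B r w) :
    (B.restrict (B.orthogonal (Submodule.span ℤ {ℓ, r}))).Nondegenerate := by
  obtain ⟨θ, hθ, hθ2, -, -, hfix⟩ := exists_isometric_involution_of_neg_vector B hs he hu hd hℓ hℓsat hrℓ hr hrsat hdvd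
  have hB : B.Nondegenerate := hu.nondegenerate
  have key : ∀ v : B.orthogonal (Submodule.span ℤ {ℓ, r}),
      (∀ w : B.orthogonal (Submodule.span ℤ {ℓ, r}), B v w = 0) → v = 0 := by
    intro v hv
    have hvfix : θ v = v := (hfix v).2 (by
      have := (mem_orthogonal_span_pair_iff B).1 v.2
      rw [hs.eq ℓ v, hs.eq r v] at this
      exact this)
    have h2 : ∀ u : M, 2 * B v u = 0 := fun u ↦ by
      have hmem : u + θ u ∈ B.orthogonal (Submodule.span ℤ {ℓ, r}) := by
        rw [mem_orthogonal_span_pair_iff, hs.eq ℓ, hs.eq r, ← (hfix _)]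
        rw [map_add, hθ2, add_comm]
      have := hv ⟨u + θ u, hmem⟩
      rw [Subtype.coe_mk, map_add] at this
      have h' : B v (θ u) = B v u := by rw [← hvfix, hθ, hvfix]
      linarith
    exact Subtype.ext (hB.1 v fun u ↦ by have := h2 u; omega)
  refine ⟨fun v hv ↦ key v fun w ↦ hv w, fun v hv ↦ key v fun w ↦ ?_⟩
  rw [hs.eq]
  exact hv w

/-- **GHS Lemma 4.5 applied to `σ̃_r`: `L_r = r^⊥_{L_{2d}} = {ℓ, r}^⊥ ⊂ Λ` is `2`-elementary** — for any even
unimodular `Λ`, `ℓ` primitive with `(ℓ,ℓ) = 2d > 0`, and `r ⊥ ℓ` primitive with `(r,r) = −2d`, `d ∣ (r, ℓ^⊥)`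
(`L_r` is the invariant lattice of the involution `σ̃_r`). [cite: GritsenkoHulekSankaran2007Kodaira, §4 (arXiv numbering) Lemma 4.5 and proof of Prop. 4.6 ("It follows from Lemma 4.5 that `L_r` and `S_r` are `2`-elementary lattices")] [cite: AlexeevNikulin2006, §2.2] -/
theorem isTwoElementary_restrict_orthogonal_span_pair_of_neg_vector (hs : B.IsSymm) (he : B.IsEven)
    (hu : B.IsUnimodular) {ℓ r : M} {d : ℤ} (hd : 0 < d) (hℓ : B ℓ ℓ = 2 * d)
    (hℓsat : ∀ (k : ℤ) (w : M), k ≠ 0 → k • w ∈ ℤ ∙ ℓ → w ∈ ℤ ∙ ℓ) (hrℓ : B r ℓ = 0) (hr : B r r = -(2 * d))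
    (hrsat : ∀ (k : ℤ) (w : M), k ≠ 0 → k • w ∈ ℤ ∙ r → w ∈ ℤ ∙ r) (hdvd : ∀ w, B w ℓ = 0 → d ∣ B r w) :
    (B.restrict (B.orthogonal (Submodule.span ℤ {ℓ, r}))).IsTwoElementary := by
  haveI : IsAddTorsionFree M := Module.isTorsionFree_int_iff_isAddTorsionFree.1 inferInstance
  obtain ⟨θ, hθ, hθ2, -, -, hfix⟩ := exists_isometric_involution_of_neg_vector B hs he hu hd hℓ hℓsat hrℓ hr hrsat hdvd
  refine B.isTwoElementary_restrict_of_involution_invariant θ _ hu hθ hθ2 fun x ↦ ?_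
  rw [mem_orthogonal_span_pair_iff, hfix, hs.eq x ℓ, hs.eq x r]

/-- **`S_r = (L_r)^⊥` is the anti-invariant lattice of `σ̃_r`**: `w ⊥ L_r ⟺ σ̃w = −w` (for `w ⊥ L_r`,
`w + σ̃w ∈ L_r ∩ L_r^⊥ = 0` by the nondegeneracy of `L_r`; conversely `(w, k) = (σ̃w, σ̃k) = (−w, k)`).
[cite: GritsenkoHulekSankaran2007Kodaira, §4 (arXiv numbering) proof of Prop. 4.6 ("`S_r = (L_r)^⊥_{L_{K3}}` … `σ̃_r|_{S_r} = −id_{S_r}`")] -/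
theorem mem_orthogonal_orthogonal_span_pair_iff_of_neg_vector (hs : B.IsSymm) (he : B.IsEven) (hu : B.IsUnimodular)
    {ℓ r : M} {d : ℤ} (hd : 0 < d) (hℓ : B ℓ ℓ = 2 * d)
    (hℓsat : ∀ (k : ℤ) (w : M), k ≠ 0 → k • w ∈ ℤ ∙ ℓ → w ∈ ℤ ∙ ℓ) (hrℓ : B r ℓ = 0) (hr : B r r = -(2 * d))
    (hrsat : ∀ (k : ℤ) (w : M), k ≠ 0 → k • w ∈ ℤ ∙ r → w ∈ ℤ ∙ r) (hdvd : ∀ w, B w ℓ = 0 → d ∣ B r w)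
    {θ : M →ₗ[ℤ] M} (hθ : ∀ x y, B (θ x) (θ y) = B x y) (hθ2 : ∀ x, θ (θ x) = x)
    (hfix : ∀ w, θ w = w ↔ B w ℓ = 0 ∧ B w r = 0) (w : M) :
    w ∈ B.orthogonal (B.orthogonal (Submodule.span ℤ {ℓ, r})) ↔ θ w = -w := by
  have hK : ∀ x, x ∈ B.orthogonal (Submodule.span ℤ {ℓ, r}) ↔ θ x = x := fun x ↦ by
    rw [mem_orthogonal_span_pair_iff, hfix, hs.eq x ℓ, hs.eq x r]
  rw [LinearMap.BilinForm.mem_orthogonal_iff]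
  constructor
  · intro hw
    -- `v = w + θ w ∈ L_r ∩ L_r^⊥`
    have hv : w + θ w ∈ B.orthogonal (Submodule.span ℤ {ℓ, r}) := by rw [hK, map_add, hθ2, add_comm]
    have hv' : ∀ k : B.orthogonal (Submodule.span ℤ {ℓ, r}), B (w + θ w) k = 0 := fun k ↦ by
      have hk : θ k = k := (hK k).1 k.2
      have h1 : B k w = 0 := hw k k.2
      have h2 : B k (θ w) = 0 := by rw [← hk, hθ]; exact h1
      rw [map_add, LinearMap.add_apply, hs.eq w k, hs.eq (θ w) k, h1, h2, add_zero]
    have hnd := nondegenerate_restrict_orthogonal_span_pair_of_neg_vector B hs he hu hd hℓ hℓsat hrℓ hr hrsat hdvd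
    have h0 : (⟨w + θ w, hv⟩ : B.orthogonal (Submodule.span ℤ {ℓ, r})) = 0 :=
      hnd.1 _ fun k ↦ hv' k
    have h0' : w + θ w = 0 := congrArg Subtype.val h0
    exact eq_neg_of_add_eq_zero_right h0'
  · intro hw n hn
    have hn' : θ n = n := (hK n).1 hn
    change B n w = 0
    have h := hθ n w
    rw [hn', hw, map_neg] at h
    linarith

/-- **GHS Lemma 4.5 applied to `σ̃_r`: `S_r = (L_r)^⊥` is `2`-elementary** (it is the anti-invariant lattice of the
involution `σ̃_r` of the even unimodular `Λ`; it contains `ℤℓ ⊕ ℤr` with finite index).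
[cite: GritsenkoHulekSankaran2007Kodaira, §4 (arXiv numbering) Lemma 4.5 and proof of Prop. 4.6] [cite: AlexeevNikulin2006, §2.2] -/
theorem isTwoElementary_restrict_orthogonal_orthogonal_span_pair_of_neg_vector (hs : B.IsSymm) (he : B.IsEven)
    (hu : B.IsUnimodular) {ℓ r : M} {d : ℤ} (hd : 0 < d) (hℓ : B ℓ ℓ = 2 * d)
    (hℓsat : ∀ (k : ℤ) (w : M), k ≠ 0 → k • w ∈ ℤ ∙ ℓ → w ∈ ℤ ∙ ℓ) (hrℓ : B r ℓ = 0) (hr : B r r = -(2 * d))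
    (hrsat : ∀ (k : ℤ) (w : M), k ≠ 0 → k • w ∈ ℤ ∙ r → w ∈ ℤ ∙ r) (hdvd : ∀ w, B w ℓ = 0 → d ∣ B r w) :
    (B.restrict (B.orthogonal (B.orthogonal (Submodule.span ℤ {ℓ, r})))).IsTwoElementary := by
  haveI : IsAddTorsionFree M := Module.isTorsionFree_int_iff_isAddTorsionFree.1 inferInstance
  obtain ⟨θ, hθ, hθ2, -, -, hfix⟩ := exists_isometric_involution_of_neg_vector B hs he hu hd hℓ hℓsat hrℓ hr hrsat hdvd
  exact B.isTwoElementary_restrict_of_involution_antiInvariant θ _ hu hθ hθ2 fun x ↦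
    mem_orthogonal_orthogonal_span_pair_iff_of_neg_vector B hs he hu hd hℓ hℓsat hrℓ hr hrsat hdvd hθ hθ2 hfix x

end TwoElementary

end Literature.Topology.FourManifolds

end
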